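import Literature.Probability.RandomPlanarGeometry.HexSAWModes
import HarnessLib

/-!
# The first-arrival turning law: the modes at a vertex are two characters of ONE positive law

Topic `Literature/Probability/RandomPlanarGeometry`; continuation of `HexSAWModes.lean` (coordinate model `HV`, mid-edge
walks from the standard entrance `wOut → hvOrigin`, parafermionic weights `pwt P = x_c^ℓ λ^{pturn P}`, `λ = e^{-i5π/24}`).
Source: H. Duminil-Copin, S. Smirnov, Ann. of Math. 175 (2012), 1653–1665 (arXiv:1007.0575), §2: "we define its winding
`W_γ(a,b)` as the total rotation of the direction in radians when `γ` is traversed from `a` to `b`" — on the honeycomb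
lattice the direction after `k` turns of `±π/3` is the initial direction rotated by `ω^{pturn}`, `ω = e^{iπ/3}`
(`IsMidWalk.edir_finalDart`, a one-line induction with `IsMidWalk.dropLast_spec`).

Consequence recorded here: bin the FIRST ARRIVALS at `v` (class `clsIn V v`) by their total turning `J = pturn P ∈ ℤ`;
the masses `turnMass V v J = Σ_{pturn P = J} x_c^{ℓ(P)}` are NON-NEGATIVE reals (`turnMass_nonneg`), and
* `sum_clsIn_pwt_eq`: `Σ_{clsIn} pwt = Σ_J turnMass J · λ^J` — the sum mode of the first arrivals is the character
  `J ↦ λ^J = e^{-i·37.5°·J}` of the turning law;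
* `sum_clsIn_inv_edir_pwt_eq`: `Σ_{clsIn} (edir v s_P)⁻¹ pwt P = -(edir wOut O)⁻¹ Σ_J turnMass J · (λ ω⁻¹)^J` — the
  conjugate-direction (Beltrami) mode is the character `J ↦ (λω⁻¹)^J = e^{-i·97.5°·J}` of the SAME law (times a unit).
With `HexSAWModes` (`Σ_{clsOut} = x_c(λ+λ⁻¹) Σ_{clsIn}`, resp. `x_c(λ⁻¹⁷-λ⁻⁷)` for the twisted sums) and
`HexParafermionModeIdentities` (transport to `F(a,·,x_c,5/8)`), the quotient `‖F₀+ωF₁+ω²F₂‖/‖F₀+F₁+F₂‖` at a vertex of a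
hexagonal domain is, up to the loop walks, `0.6140… × |ĝ(97.5°)| / |ĝ(37.5°)|` for the two characters `ĝ` of one finitely
supported law `J ↦ turnMass J ≥ 0`. Deliberately NOT here: anything about the loop class or about limits.
-/

noncomputable section

open Finset

namespace Literature.Probability.RandomPlanarGeometry.SAW

namespace HV

variable {V : Finset HV} {P : List HV} {v : HV}

/-- `ω² = -ω⁻¹` (`ω³ = -1`). [folklore] -/
theorem omg_sq_eq_neg_inv : omg ^ 2 = -omg⁻¹ := by
  have h3 : omg ^ 2 * omg = -1 := by rw [← pow_succ]; exact omg_pow_three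
  calc omg ^ 2 = omg ^ 2 * omg * omg⁻¹ := by rw [mul_assoc, mul_inv_cancel₀ omg_ne_zero, mul_one]
    _ = -omg⁻¹ := by rw [h3, neg_one_mul]

/-- **The direction of the final dart is the entrance direction rotated by the turning**: for a mid-edge walk `P`
from the standard entrance, `edir (finalDart P) = edir wOut O · ω^{pturn P}`.
[cite: DuminilCopinSmirnov2012, §2 ("the total rotation of the direction")] -/
theorem IsMidWalk.edir_finalDart (hw : wOut ∉ V) :
    ∀ (n : ℕ) (P : List HV), P.length = n → IsMidWalk V P →
      edir (finalDart P).1 (finalDart P).2 = edir wOut hvOrigin * omg ^ pturn P := by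
  intro n
  induction n using Nat.strong_induction_on with
  | _ n ih =>
    intro P hlen hP
    rcases hP.trivial_or_exists with rfl | ⟨l, u, hl, rfl⟩
    · rw [finalDart_trivial, pturn_two, zpow_zero, mul_one]
    · set Q := wOut :: (l ++ [u]) with hQdef
      have hv : (finalDart Q).1 = l.getLast hl := by rw [finalDart_cons_append hl]
      have hvV : l.getLast hl ∈ V := ((isMidWalk_cons_append_iff V hl u).1 hP).2.2.2.1 _ (List.getLast_mem hl)
      obtain ⟨hQd, hfd2, hvi, hadj, hor⟩ := hP.dropLast_spec hw hvV hv
      have hlt : Q.dropLast.length < n := by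
        rw [List.length_dropLast, ← hlen]
        exact Nat.sub_lt (by simp [hQdef]) one_pos
      have IH := ih _ hlt Q.dropLast rfl hQd
      set s := (finalDart Q.dropLast).1 with hs
      have IH' : edir s (l.getLast hl) = edir wOut hvOrigin * omg ^ pturn Q.dropLast := by
        rw [← hfd2]; exact IH
      have hp := hQd.pturn_append_singleton
      rcases hor with hQ | hQ
      · have hfd : finalDart Q = (l.getLast hl, ccw (l.getLast hl) s) := by
          have := (hQd.append_singleton hfd2 hvV hvi (adj_ccw _ _) (ccw_ne _ _)).2.1
          rwa [← hQ] at this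
        have hpQ : pturn Q = pturn Q.dropLast + -1 := by
          have := hp (ccw (l.getLast hl) s)
          rwa [← hQ, hfd2, turn_ccw hadj] at this
        rw [hfd, hpQ, edir_ccw hadj, edir_rev, IH', ← zpow_natCast, zpow_add₀ omg_ne_zero]
        push_cast
        rw [show ((-1 : ℤ)) = -(1 : ℤ) from rfl, zpow_neg, zpow_one, zpow_ofNat, omg_sq_eq_neg_inv]
        ring
      · have hfd : finalDart Q = (l.getLast hl, cw (l.getLast hl) s) := by
          have := (hQd.append_singleton hfd2 hvV hvi (adj_cw _ _) (cw_ne hadj)).2.1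
          rwa [← hQ] at this
        have hpQ : pturn Q = pturn Q.dropLast + 1 := by
          have := hp (cw (l.getLast hl) s)
          rwa [← hQ, hfd2, turn_cw hadj] at this
        rw [hfd, hpQ, edir_cw hadj, edir_rev, IH', zpow_add_one₀ omg_ne_zero]
        ring

/-- For a first arrival at `v` (class `clsIn`), the direction from `v` back along its final dart is
`-(edir wOut O) ω^{pturn P}`. [folklore] -/
theorem edir_of_mem_clsIn (hw : wOut ∉ V) (hP : P ∈ clsIn V v) :
    edir v (finalDart P).1 = -(edir wOut hvOrigin * omg ^ pturn P) := by
  obtain ⟨hW, hv2, -⟩ := mem_clsIn_iff.1 hP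
  rw [edir_rev, ← hv2]
  exact congrArg Neg.neg (IsMidWalk.edir_finalDart hw _ P rfl hW)

/-! ### The turning law of the first arrivals and its two characters -/

variable (V v) in
/-- **The turning law of the first arrivals at `v`**: the total `x_c`-mass of the first arrivals (class `clsIn V v`)
whose total turning is `J` (in units of `π/3`). A non-negative real, non-zero for finitely many `J`.
[cite: DuminilCopinSmirnov2012, §2 (winding as total rotation; Definition 1)] -/
def turnMass (J : ℤ) : ℝ := ∑ P ∈ (clsIn V v).filter (fun P => pturn P = J), hexCriticalFugacity ^ mwLen P

/-- The turning masses are non-negative. [folklore] -/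
theorem turnMass_nonneg (J : ℤ) : 0 ≤ turnMass V v J :=
  sum_nonneg fun _ _ => pow_nonneg (le_of_lt (by rw [hexCriticalFugacity]; positivity)) _

/-- **Sum mode = the `λ`-character of the turning law**: `Σ_{clsIn} pwt = Σ_J turnMass J · λ^J`
(`λ^J = e^{-i·37.5°·J}`). [cite: DuminilCopinSmirnov2012, Definition 1] -/
theorem sum_clsIn_pwt_eq :
    ∑ P ∈ clsIn V v, pwt P = ∑ J ∈ (clsIn V v).image pturn, (turnMass V v J : ℂ) * lam ^ J := by
  classical
  rw [← sum_fiberwise_of_maps_to (g := pturn) (fun P hP => mem_image_of_mem pturn hP)]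
  refine sum_congr rfl fun J _ => ?_
  rw [turnMass, Complex.ofReal_sum, sum_mul]
  refine sum_congr rfl fun P hP => ?_
  rw [(mem_filter.1 hP).2.symm, pwt, Complex.ofReal_pow]

/-- **Beltrami mode = the `λω⁻¹`-character of the same law**: with the conjugate-direction weights,
`Σ_{P ∈ clsIn} (edir v s_P)⁻¹ pwt P = -(edir wOut O)⁻¹ · Σ_J turnMass J · (λ ω⁻¹)^J` (`(λω⁻¹)^J = e^{-i·97.5°·J}`,
which on a class of fixed parity of `J` is `± e^{+i·82.5°·J}`). [cite: DuminilCopinSmirnov2012, Definition 1] -/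
theorem sum_clsIn_inv_edir_pwt_eq (hw : wOut ∉ V) :
    ∑ P ∈ clsIn V v, (edir v (finalDart P).1)⁻¹ * pwt P =
      -(edir wOut hvOrigin)⁻¹ * ∑ J ∈ (clsIn V v).image pturn, (turnMass V v J : ℂ) * (lam * omg⁻¹) ^ J := by
  classical
  rw [mul_sum, ← sum_fiberwise_of_maps_to (g := pturn) (fun P hP => mem_image_of_mem pturn hP)]
  refine sum_congr rfl fun J _ => ?_
  rw [turnMass, Complex.ofReal_sum, sum_mul, mul_sum]
  refine sum_congr rfl fun P hP => ?_
  obtain ⟨hPin, hJ⟩ := mem_filter.1 hP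
  rw [edir_of_mem_clsIn hw hPin, ← hJ, pwt, Complex.ofReal_pow, mul_zpow, inv_zpow, inv_neg, mul_inv]
  ring

end HV

end Literature.Probability.RandomPlanarGeometry.SAW

end
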